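import Mathlib
import Summits.ValiantsHypothesis.ValiantsHypothesis.Theorems.ProofCarryingSymmetryRestorationQPESatDefs

/-!
# Route ProofCarryingSymmetry — crux `RestorationQP`, line `registered`: the maximal peeling count `kmax`

Support file for the crux item `stmt-ValiantsHypothesis-10343` (lead c5, rung S3^(1)-inv, stub
`esat_kmax_spec`).  The e-saturation `esat` (…`ESatDefs`) peels, at the root of a normal product,
`k = kmax K D` copies of the pattern `D` out of the multiset `K` of factor classes, where
`kmax K D = min_{d ∈ D} ⌊K.count d / D.count d⌋` (and `0` for `D = 0`).  This file proves the
elementary multiset arithmetic of `kmax` used by the later parts: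

* `le_kmax_iff` / `esat_kmax_spec` — the SPECIFICATION: for `D ≠ 0`, `j ≤ kmax K D ↔ j • D ≤ K`,
  i.e. `kmax K D` is the largest `k` with `k • D ≤ K`;
* `kmax_zero_right`, `nsmul_kmax_le`, `kmax_eq_zero_iff`, `kmax_mono`,
  `kmax_add_of_forall_not_mem` (factors outside the pattern do not matter), `kmax_sub_nsmul`
  (peeling `j` copies lowers `kmax` by `j`), `kmax_self`, `kmax_map_of_injective` (invariance
  under an injective relabelling — used for the equivariance of `esat` under renaming).

Everything here is elementary and proved.
-/

-- single-problem summit: `Summit.ValiantsHypothesis.ValiantsHypothesis.…` is the namespace by design (D-0017)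
set_option linter.dupNamespace false

noncomputable section

open scoped Classical

namespace Summit.ValiantsHypothesis.ValiantsHypothesis.Theorems

namespace ACStability

open Literature.Computability.AlgebraicComplexity ACClass

universe u v

variable {α : Type u} {β : Type v}

/-! ### The specification -/

/-- **Specification of `kmax`.**  For `D ≠ 0`: `j ≤ kmax K D ↔ j • D ≤ K`, i.e. `kmax K D` is the
largest `k` with `k • D ≤ K`. [folklore] -/
theorem le_kmax_iff {K D : Multiset α} (hD : D ≠ 0) (j : ℕ) : j ≤ kmax K D ↔ j • D ≤ K := by
  have hne : D.toFinset.Nonempty := Multiset.toFinset_nonempty.mpr hD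
  rw [kmax, dif_pos hne, Finset.le_inf'_iff, Multiset.le_iff_count]
  simp only [Multiset.mem_toFinset, Multiset.count_nsmul]
  constructor
  · intro h a
    by_cases ha : a ∈ D
    · exact (Nat.le_div_iff_mul_le (Multiset.count_pos.mpr ha)).mp (h a ha)
    · rw [Multiset.count_eq_zero_of_notMem ha, Nat.mul_zero]
      exact Nat.zero_le _
  · intro h a ha
    exact (Nat.le_div_iff_mul_le (Multiset.count_pos.mpr ha)).mpr (h a)

/-! ### Consequences -/

/-- Nothing peels against the empty pattern. [folklore] -/
@[simp] theorem kmax_zero_right (K : Multiset α) : kmax K 0 = 0 := by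
  simp [kmax]

/-- `kmax K D` copies of `D` do fit into `K`. [folklore] -/
theorem nsmul_kmax_le (K D : Multiset α) : kmax K D • D ≤ K := by
  by_cases hD : D = 0
  · simp [hD]
  · exact (le_kmax_iff hD _).mp le_rfl

/-- `kmax K D = 0` iff not even one copy of `D` fits (`D ≠ 0`). [folklore] -/
theorem kmax_eq_zero_iff {K D : Multiset α} (hD : D ≠ 0) : kmax K D = 0 ↔ ¬ D ≤ K := by
  rw [← Nat.lt_one_iff, ← not_le, le_kmax_iff hD, one_nsmul]

/-- `kmax` is monotone in the first argument. [folklore] -/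
theorem kmax_mono {K K' : Multiset α} (h : K ≤ K') (D : Multiset α) : kmax K D ≤ kmax K' D := by
  by_cases hD : D = 0
  · simp [hD]
  · exact (le_kmax_iff hD _).mpr ((nsmul_kmax_le K D).trans h)

/-- Adding elements outside the pattern does not change `kmax`. [folklore] -/
theorem kmax_add_of_forall_not_mem (K : Multiset α) {E D : Multiset α} (hE : ∀ x ∈ E, x ∉ D) :
    kmax (K + E) D = kmax K D := by
  by_cases hD : D = 0
  · simp [hD]
  refine eq_of_forall_le_iff fun j => ?_
  rw [le_kmax_iff hD, le_kmax_iff hD]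
  refine ⟨fun h => ?_, fun h => h.trans (Multiset.le_add_right K E)⟩
  rw [Multiset.le_iff_count] at h ⊢
  intro a
  by_cases ha : a ∈ D
  · have hEa : a ∉ E := fun hx => hE a hx ha
    simpa [Multiset.count_add, Multiset.count_eq_zero_of_notMem hEa] using h a
  · simp [Multiset.count_nsmul, Multiset.count_eq_zero_of_notMem ha]

/-- Peeling `j` copies of the pattern lowers `kmax` by exactly `j`. [folklore] -/
theorem kmax_sub_nsmul {K D : Multiset α} {j : ℕ} (hj : j • D ≤ K) :
    kmax (K - j • D) D = kmax K D - j := by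
  by_cases hD : D = 0
  · subst hD
    simp
  refine eq_of_forall_le_iff fun i => ?_
  rw [le_kmax_iff hD, Nat.le_sub_iff_add_le ((le_kmax_iff hD j).mpr hj), le_kmax_iff hD,
    le_tsub_iff_right hj, add_nsmul]

/-- A nonempty pattern fits exactly once into itself. [folklore] -/
theorem kmax_self {D : Multiset α} (hD : D ≠ 0) : kmax D D = 1 := by
  refine le_antisymm (not_lt.mp fun h => ?_) ((le_kmax_iff hD 1).mpr (by rw [one_nsmul]))
  have h2 : 2 • D ≤ D := (le_kmax_iff hD 2).mp (Nat.succ_le_of_lt h)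
  have hc := Multiset.card_le_card h2
  rw [Multiset.card_nsmul] at hc
  have hpos : 0 < D.card := Multiset.card_pos.mpr hD
  omega

/-- `kmax` is invariant under an injective relabelling. [folklore] -/
theorem kmax_map_of_injective {f : α → β} (hf : Function.Injective f) (K D : Multiset α) :
    kmax (K.map f) (D.map f) = kmax K D := by
  by_cases hD : D = 0
  · subst hD
    simp
  have hD' : D.map f ≠ 0 := fun h => hD (Multiset.map_eq_zero.mp h)
  refine eq_of_forall_le_iff fun j => ?_
  rw [le_kmax_iff hD', le_kmax_iff hD, ← Multiset.map_nsmul, Multiset.map_le_map_iff hf]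

end ACStability

/-- **Registered stub `esat_kmax_spec`.**  `kmax K D` is the largest `k` with `k • D ≤ K`
(`D ≠ 0`). [folklore] -/
theorem esat_kmax_spec : ∀ {α : Type} (K D : Multiset α) (j : ℕ), D ≠ 0 → (j ≤ ACStability.kmax K D ↔ j • D ≤ K) :=
  fun K _ j hD => ACStability.le_kmax_iff (K := K) hD j

end Summit.ValiantsHypothesis.ValiantsHypothesis.Theorems

end
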